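import Mathlib
import Summits.Parity.BatemanHorn.Theses.PolynomialMobius
import Summits.Parity.BatemanHorn.Theses.IsogenyRedei
import Summits.Parity.BatemanHorn.Theorems.IsogenyRedeiPolyMobiusTailStubEventuallyTwoLe
import Summits.Parity.BatemanHorn.Theorems.IsogenyRedeiPolyMobiusTailStubKernelFinOne
import Summits.Parity.BatemanHorn.Theorems.IsogenyRedeiPolyMobiusTailStubSignedTypeIOfKernel
import Summits.Parity.BatemanHorn.Theorems.IsogenyRedeiPolyMobiusTailStubStripFinOne
import Summits.Parity.BatemanHorn.Theorems.IsogenyRedeiTypeIMainTermComponents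
import Summits.Parity.BatemanHorn.Theorems.IsogenyRedeiTypeIMainTermCounting
import Summits.Parity.BatemanHorn.Theorems.PolyMobiusTail.Negative.Structure
import Summits.Parity.BatemanHorn.Theorems.IsogenyRedeiPolyMobiusTailStubKernelSumEq
import Summits.Parity.BatemanHorn.Theorems.IsogenyRedeiPolyMobiusTailStubCoeffAFunEqSum
import Summits.Parity.BatemanHorn.Theorems.IsogenyRedeiPolyMobiusTailStubEFunLogpowSummable
import Summits.Parity.BatemanHorn.Theorems.IsogenyRedeiPolyMobiusTailStubConvRate
import Summits.Parity.BatemanHorn.Theorems.IsogenyRedeiPolyMobiusTailStubStripCore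
import Summits.Parity.BatemanHorn.Theorems.IsogenyRedeiPolyMobiusTailStubTupleRootCountMean
import Summits.Parity.BatemanHorn.Theorems.IsogenyRedeiPolyMobiusTailKernelTwoLe
import Summits.Parity.BatemanHorn.Theorems.IsogenyRedeiPolyMobiusTailStripTwoLe
import Summits.Parity.BatemanHorn.Theorems.PolyMobiusTail.Negative.Equivalence
import Summits.Parity.BatemanHorn.Theorems.IsogenyRedeiTypeIMainTerm
import Literature.NumberTheory.LFunctions.PrimeNumberTheoremProgressions
import Literature.NumberTheory.Sieve.AletheiaZomleferFukshanskyGarcia2020Applications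
import Summits.Parity.BatemanHorn.Theorems.IsogenyRedeiPolyMobiusTailNaturalFormReduction

/-!
# Skeleton — crux stmt-Parity-0870 `PolyMobiusTail`, line `Sketch` (natural form with a log cut-off)

Lead provers `prover-line-stmt-Parity-0870-0` (v1–v5) and `prover-line-stmt-Parity-0870-c1-0` (v6, this
file), reshaped from ideator 2's `SketchIdeator2.lean` (card `natural-form-affine-hooley-window`).

Composition (all glue PROVED in this file; `sorry` only inside OPEN `stub_*`):

* pointwise S-expansion (stub 1, LANDED p86921) + eventual size of the values (stub 2, LANDED p85893);
* the analytic KERNEL (truncated signed singular sums with a bare Möbius factor, log-power rate):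
  k = 1 LANDED p92887 (Landau's M-form, Literature p90535 + p92627); k ≥ 2 = `stub_kernel_two_le`,
  which v6 REDUCES to four registered stubs over the tree's Type-I-main-term apparatus
  (`Theorems/IsogenyRedeiTypeIMainTerm*.lean`, stmt-Parity-0873, landed 2026-08-16): the dual-number
  generating function `𝒶 = 𝓮 ⋆ ∏ 𝒻ᵢ` in `Λ_k = ℝ[εᵢ]/(εᵢ²)`:
  - `stub_kernel_sum_eq` — our kernel sum `V_S(y)` IS `Σ_{m ≤ y} [ε_{univ∖S}] 𝒶(m)` (CRT count identity);
  - `stub_coeff_aFun_eq_sum` — `[ε_T] 𝒶(m) = Σ_{J ⊆ T} (E^{T∖J} ⋆ F_J)(m)` (exact identity, all `T`);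
  - `stub_eFun_logpow_summable` — `Σ_n ‖𝓮(n)‖ (1 + log n)^B < ∞` for every `B` (Euler control with logs);
  - `stub_conv_rate` — abstract: absolutely log-summable `e` ⋆ (`F` with log-rate to `0`) has log-rate;
  then `hasLogRate_prod` + `mg_mgl_rate` (tree) give `V_S(y) ≪ (log y)^{-|S|-1}` for `S ≠ ∅`;
* bookkeeping KERNEL ⟹ signed Type-I sums o(x) for S ≠ ∅, η ∈ (1/2,1) (stub 3b, LANDED p92884 + aux p92703);
* bridge 1 = `routeTailToNaturalTail_of_stubs` (proved here from the above);
* the strip between x^{1-η} and x/(log x)^{2k+2}: k = 1 LANDED p96881 (`…StubStripFinOne{A,B,C,}.lean`);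
  k ≥ 2 = `stub_strip_two_le`, which v6 REDUCES to `stub_strip_core` (swap + period with the EXACT
  root-count error, all `T ⊆ Fin k`), `stub_tuple_rootCount_mean` (`Σ_{∏dᵢ ≤ y} μ²(d) ρ(d) ≪ y (log y)^k`),
  the kernel (T ≠ ∅) and the convergence of the log-weighted singular series (T = ∅, tree:
  `tendsto_sum_coeff_univ_aFun`);
* `stub_naturalLogTail` (C⁺, OPEN = the crux in natural form: certified crux-equivalent modulo
  TypeIMainTerm + bridges, `Cruxes/PolyMobiusTail/StubFiveEquivalence.lean`);
* `PolyMobiusTail_of` concludes `…Theses.PolynomialMobius.PolyMobiusTail` BY NAME (η = 3/4; k = 0 via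
  `Negative.Structure.polyMobiusTail_fin_zero`), `PolyMobiusTail_of_isogenyRedei` the identical IsogenyRedei decl.

So for ONE polynomial (k = 1) every theorem-grade piece of the line is in the tree; v6 makes the k ≥ 2
theorem-grade pieces six well-sized stubs over landed infrastructure.

v7 (lead c1, end of cycle 1): EVERY theorem-grade piece of the line is LANDED in the tree for every k and is
imported here — K1 p101266, K2 p101225, K3 p102032, K4 p101265, S1 p101960, S2 p103393, the strip auxiliaries
p103559, the kernel `stub_kernel_two_le` p105579 (`…KernelTwoLe.lean`), the strip `stub_strip_two_le` p107914
(`…StripTwoLe.lean`), bridge 1 for every k p107793 (`…NaturalFormReductionAux.lean`) and the UNCONDITIONAL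
equivalence `stub_naturalLogTail_iff_polyMobiusTail : (natural log tail for every BH system) ↔ PolyMobiusTail`
p112639 (`…NaturalFormReduction.lean`, via `typeIMainTerm_proof`; not imported here until the farm has built it).
The ONLY `sorry` is `stub_naturalLogTail`,
which is therefore exactly the crux (its parity content), restated in natural form.

v8 (lead c2, `prover-line-stmt-Parity-0870-c2-0`): the composition is split by system class. The degree-one
slice (`k = 1`, `deg f₀ = 1`: the systems `(qX + a)`, exactly those for which Bateman–Horn is KNOWN) is the new
registered stub `stub_degreeOneSlice`, a THEOREM (PNT in arithmetic progressions in `Λ`-form against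
`typeIMainTerm_proof`; work/stubs/StubDegreeOneSlice.lean, sorry-free, std axioms; lands as
`Theorems/IsogenyRedeiPolyMobiusTailStubDegreeOneSlice.lean`, p114749 ACCEPTED; v8.1 carries a local copy of the landed proof until the farm has built that module); every other
system goes through `tail_of_stubs` (bridge 1 + strip + `stub_naturalLogTail`). Registered stubs:
`stub_degreeOneSlice` (LANDED), `stub_naturalLogTail` (= the crux off the degree-one slice = Λ-Bateman–Horn in
every OPEN case). Sorries: 1 (`stub_naturalLogTail`).
-/

open scoped BigOperators Topology
open Filter Finset Polynomial Asymptotics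

namespace Summit.Parity.BatemanHorn.Cruxes.PolyMobiusTail.NaturalForm

open Literature.NumberTheory.Sieve
open Summit.Parity.BatemanHorn.Theorems.TypeIMainTerm

/-! ## The five stubs (statements inline — no definitions — so that landed helper files match literally) -/

/-! ### Local copy of the landed proof of stub 1 (the tree module
`IsogenyRedeiPolyMobiusTailStubPointwise` is not yet built on the farm; byte-identical proof, p86921) -/
namespace PointwiseLocal

/-- Möbius inversion at a point: `Σ_{x ∣ m} μ(x) = 0` (cast to `ℝ`) whenever `m ≠ 1`
(for `m = 0` the divisor set is empty). [folklore] -/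
theorem pointwise_sum_divisors_moebius_eq_zero {m : ℕ} (hm : m ≠ 1) :
    ∑ x ∈ m.divisors, (ArithmeticFunction.moebius x : ℝ) = 0 := by
  rw [← Int.cast_sum, ← ArithmeticFunction.coe_mul_zeta_apply,
    ArithmeticFunction.moebius_mul_coe_zeta, ArithmeticFunction.one_apply_ne hm, Int.cast_zero]

/-- For a non-empty index set `S`, the untruncated signed sum
`Σ_{d : dᵢ ∣ mᵢ} (∏ᵢ μ(dᵢ)) ∏_{i ∉ S} log dᵢ` factorises over the coordinates and the factor at any
`i₀ ∈ S` is `Σ_{x ∣ m_{i₀}} μ(x) = 0` (as `m_{i₀} ≠ 1`). [folklore] -/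
theorem pointwise_full_sum_eq_zero {k : ℕ} (m : Fin k → ℕ) (hm : ∀ i, m i ≠ 1)
    {S : Finset (Fin k)} (hS : S.Nonempty) :
    ∑ d ∈ Fintype.piFinset (fun i => (m i).divisors),
      (∏ i, (ArithmeticFunction.moebius (d i) : ℝ)) * ∏ i ∈ Finset.univ \ S, Real.log (d i) = 0 := by
  obtain ⟨i₀, hi₀⟩ := hS
  have hi₀' : i₀ ∉ Finset.univ \ S := fun h => (Finset.mem_sdiff.mp h).2 hi₀
  have h1 : ∀ d : Fin k → ℕ,
      (∏ i, (ArithmeticFunction.moebius (d i) : ℝ)) * ∏ i ∈ Finset.univ \ S, Real.log (d i)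
        = ∏ i, ((ArithmeticFunction.moebius (d i) : ℝ) *
            if i ∈ Finset.univ \ S then Real.log (d i) else 1) := by
    intro d
    rw [Finset.prod_mul_distrib, Finset.prod_ite_mem, Finset.univ_inter]
  rw [Finset.sum_congr rfl fun d _ => h1 d]
  rw [← Finset.prod_univ_sum (fun i => (m i).divisors)
    (fun i x => (ArithmeticFunction.moebius x : ℝ) * if i ∈ Finset.univ \ S then Real.log x else 1)]
  refine Finset.prod_eq_zero (Finset.mem_univ i₀) ?_
  simp only [if_neg hi₀', mul_one]
  exact pointwise_sum_divisors_moebius_eq_zero (hm i₀)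

/-- Binomial expansion `∏ᵢ μᵢ (Lᵢ - ℓᵢ) = Σ_S (-1)^{|univ \ S|} (∏_{i∈S} Lᵢ) · (∏ᵢ μᵢ) ∏_{i∉S} ℓᵢ`
(`Finset.prod_add`, then merging `(∏_S μ)(∏_{univ \ S} μ) = ∏ μ`). [folklore] -/
theorem pointwise_prod_expand {k : ℕ} (μ L ℓ : Fin k → ℝ) :
    ∏ i, (μ i * (L i - ℓ i)) = ∑ S ∈ (Finset.univ : Finset (Fin k)).powerset,
      (-1 : ℝ) ^ (Finset.univ \ S).card * (∏ i ∈ S, L i) *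
        ((∏ i, μ i) * ∏ i ∈ Finset.univ \ S, ℓ i) := by
  have h : ∀ i, μ i * (L i - ℓ i) = μ i * L i + -(μ i * ℓ i) := fun i => by ring
  simp_rw [h]
  rw [Finset.prod_add]
  refine Finset.sum_congr rfl fun S _ => ?_
  rw [Finset.prod_neg, Finset.prod_mul_distrib, Finset.prod_mul_distrib,
    ← Finset.prod_mul_prod_compl S μ, Finset.compl_eq_univ_sdiff]
  ring

/-- The non-empty members of a family of finsets are the family with `∅` erased. [folklore] -/
theorem pointwise_filter_nonempty_eq_erase {β : Type*} [DecidableEq β] (T : Finset (Finset β)) :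
    T.filter (fun S => S.Nonempty) = T.erase ∅ := by
  rw [← Finset.filter_ne']
  exact Finset.filter_congr fun S _ => Finset.nonempty_iff_ne_empty

/-- Abstract bookkeeping behind the pointwise identity: if the "natural" weight `N` expands as
`Σ_{S ∈ T} c_S · W_S`, the `S = e` term reproduces `a ·` the "route" weight `R`, and every other
untruncated sum `Σ_d W_S(d)` vanishes, then `a · Σ_{p} R - Σ_{p} N = Σ_{S ≠ e} c_S Σ_{¬p} W_S`
(complementary cut-offs `q ↔ ¬ p`). [folklore] -/
theorem pointwise_assembly {α β : Type*} (D : Finset α) (T T' : Finset β) (e : β)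
    (hT : ∀ g : β → ℝ, ∑ S ∈ T, g S = g e + ∑ S ∈ T', g S)
    (p q : α → Prop) [DecidablePred p] [DecidablePred q] (hpq : ∀ d, q d ↔ ¬p d)
    (R N : α → ℝ) (W : β → α → ℝ) (c : β → ℝ) (a : ℝ)
    (hN : ∀ d ∈ D, N d = ∑ S ∈ T, c S * W S d)
    (h0 : ∀ d ∈ D, c e * W e d = a * R d)
    (hS : ∀ S ∈ T', ∑ d ∈ D, W S d = 0) :
    a * (∑ d ∈ D, if p d then R d else 0) - (∑ d ∈ D, if p d then N d else 0)
      = ∑ S ∈ T', c S * ∑ d ∈ D, if q d then W S d else 0 := by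
  have h1 : (∑ d ∈ D, if p d then N d else 0)
      = ∑ S ∈ T, c S * ∑ d ∈ D, if p d then W S d else 0 := by
    have h : ∀ d ∈ D, (if p d then N d else 0) = ∑ S ∈ T, c S * (if p d then W S d else 0) := by
      intro d hd
      by_cases hp : p d
      · simp only [if_pos hp]
        exact hN d hd
      · simp only [if_neg hp, mul_zero, Finset.sum_const_zero]
    rw [Finset.sum_congr rfl h, Finset.sum_comm]
    refine Finset.sum_congr rfl fun S _ => ?_
    rw [Finset.mul_sum]
  have h2 : ∑ S ∈ T, c S * (∑ d ∈ D, if p d then W S d else 0)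
      = c e * (∑ d ∈ D, if p d then W e d else 0)
        + ∑ S ∈ T', c S * ∑ d ∈ D, if p d then W S d else 0 := hT _
  have h3 : c e * (∑ d ∈ D, if p d then W e d else 0)
      = a * ∑ d ∈ D, if p d then R d else 0 := by
    rw [Finset.mul_sum, Finset.mul_sum]
    refine Finset.sum_congr rfl fun d hd => ?_
    by_cases hp : p d
    · simp only [if_pos hp]
      exact h0 d hd
    · simp only [if_neg hp, mul_zero]
  have h4 : ∀ S ∈ T', (∑ d ∈ D, if p d then W S d else 0)
      = -∑ d ∈ D, if q d then W S d else 0 := by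
    intro S hS'
    have hadd : (∑ d ∈ D, if p d then W S d else 0) + (∑ d ∈ D, if q d then W S d else 0)
        = ∑ d ∈ D, W S d := by
      rw [← Finset.sum_add_distrib]
      refine Finset.sum_congr rfl fun d _ => ?_
      by_cases hp : p d
      · rw [if_pos hp, if_neg (fun hq => (hpq d).mp hq hp), add_zero]
      · rw [if_neg hp, if_pos ((hpq d).mpr hp), zero_add]
    linear_combination hadd + hS S hS'
  have h5 : ∑ S ∈ T', c S * (∑ d ∈ D, if p d then W S d else 0)
      = -∑ S ∈ T', c S * ∑ d ∈ D, if q d then W S d else 0 := by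
    rw [← Finset.sum_neg_distrib]
    refine Finset.sum_congr rfl fun S hS' => ?_
    rw [h4 S hS', mul_neg]
  linear_combination (-1 : ℝ) * h1 - h2 - h3 - h5

/-- The pointwise identity with the polynomial values abstracted to `m : Fin k → ℕ`, none equal
to `1`: `(-1)^k · route - natural = Σ_{S ≠ ∅} (-1)^{|univ \ S|} (∏_{i∈S} log mᵢ) · P_S`. [folklore] -/
theorem pointwise_nat (k : ℕ) (m : Fin k → ℕ) (hm : ∀ i, m i ≠ 1) (y : ℝ) :
    (-1 : ℝ) ^ k * (∑ d ∈ Fintype.piFinset (fun i => (m i).divisors),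
        if y < ∏ i, (d i : ℝ) then ∏ i, ((ArithmeticFunction.moebius (d i) : ℝ) * Real.log (d i))
        else 0)
      - (∑ d ∈ Fintype.piFinset (fun i => (m i).divisors),
        if y < ∏ i, (d i : ℝ) then
          ∏ i, ((ArithmeticFunction.moebius (d i) : ℝ) *
            Real.log (((m i : ℕ) : ℝ) / (d i : ℝ))) else 0)
    = ∑ S ∈ (Finset.univ : Finset (Fin k)).powerset.filter (fun S => S.Nonempty),
        (-1 : ℝ) ^ (Finset.univ \ S).card * (∏ i ∈ S, Real.log ((m i : ℕ) : ℝ)) *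
          ∑ d ∈ Fintype.piFinset (fun i => (m i).divisors),
            if ∏ i, (d i : ℝ) ≤ y then
              (∏ i, (ArithmeticFunction.moebius (d i) : ℝ)) * ∏ i ∈ Finset.univ \ S, Real.log (d i)
            else 0 := by
  have hmem : ∀ d ∈ Fintype.piFinset (fun i => (m i).divisors), ∀ i,
      ((m i : ℕ) : ℝ) ≠ 0 ∧ ((d i : ℕ) : ℝ) ≠ 0 := by
    intro d hd i
    have hi := Fintype.mem_piFinset.mp hd i
    exact ⟨Nat.cast_ne_zero.mpr (Nat.mem_divisors.mp hi).2,
      Nat.cast_ne_zero.mpr (Nat.pos_of_mem_divisors hi).ne'⟩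
  have hN : ∀ d ∈ Fintype.piFinset (fun i => (m i).divisors),
      ∏ i, ((ArithmeticFunction.moebius (d i) : ℝ) * Real.log (((m i : ℕ) : ℝ) / (d i : ℝ)))
        = ∑ S ∈ (Finset.univ : Finset (Fin k)).powerset,
          (-1 : ℝ) ^ (Finset.univ \ S).card * (∏ i ∈ S, Real.log ((m i : ℕ) : ℝ)) *
            ((∏ i, (ArithmeticFunction.moebius (d i) : ℝ)) *
              ∏ i ∈ Finset.univ \ S, Real.log (d i)) := by
    intro d hd
    have he : ∏ i, ((ArithmeticFunction.moebius (d i) : ℝ) * Real.log (((m i : ℕ) : ℝ) / (d i : ℝ)))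
        = ∏ i, ((ArithmeticFunction.moebius (d i) : ℝ) *
            (Real.log ((m i : ℕ) : ℝ) - Real.log ((d i : ℕ) : ℝ))) :=
      Finset.prod_congr rfl fun i _ => by rw [Real.log_div (hmem d hd i).1 (hmem d hd i).2]
    rw [he]
    exact pointwise_prod_expand (fun i => (ArithmeticFunction.moebius (d i) : ℝ))
      (fun i => Real.log ((m i : ℕ) : ℝ)) (fun i => Real.log ((d i : ℕ) : ℝ))
  have h0 : ∀ d ∈ Fintype.piFinset (fun i => (m i).divisors),
      (-1 : ℝ) ^ (Finset.univ \ (∅ : Finset (Fin k))).card *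
          (∏ i ∈ (∅ : Finset (Fin k)), Real.log ((m i : ℕ) : ℝ)) *
          ((∏ i, (ArithmeticFunction.moebius (d i) : ℝ)) *
            ∏ i ∈ Finset.univ \ (∅ : Finset (Fin k)), Real.log (d i))
        = (-1 : ℝ) ^ k * ∏ i, ((ArithmeticFunction.moebius (d i) : ℝ) * Real.log (d i)) := by
    intro d _
    rw [Finset.sdiff_empty, Finset.card_univ, Fintype.card_fin, Finset.prod_empty, mul_one,
      ← Finset.prod_mul_distrib]
  have hS : ∀ S ∈ (Finset.univ : Finset (Fin k)).powerset.filter (fun S => S.Nonempty),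
      ∑ d ∈ Fintype.piFinset (fun i => (m i).divisors),
        (∏ i, (ArithmeticFunction.moebius (d i) : ℝ)) * ∏ i ∈ Finset.univ \ S, Real.log (d i)
          = 0 :=
    fun S hS => pointwise_full_sum_eq_zero m hm (Finset.mem_filter.mp hS).2
  have hsplit : ∀ g : Finset (Fin k) → ℝ, ∑ S ∈ (Finset.univ : Finset (Fin k)).powerset, g S
      = g ∅ + ∑ S ∈ (Finset.univ : Finset (Fin k)).powerset.filter (fun S => S.Nonempty), g S := by
    intro g
    rw [← Finset.add_sum_erase (Finset.univ : Finset (Fin k)).powerset g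
      (Finset.empty_mem_powerset _), pointwise_filter_nonempty_eq_erase]
  exact pointwise_assembly (Fintype.piFinset (fun i => (m i).divisors)) _ _ ∅ hsplit
    (fun d => y < ∏ i, (d i : ℝ)) (fun d => ∏ i, (d i : ℝ) ≤ y) (fun d => not_lt.symm)
    (fun d => ∏ i, ((ArithmeticFunction.moebius (d i) : ℝ) * Real.log (d i)))
    (fun d => ∏ i, ((ArithmeticFunction.moebius (d i) : ℝ) *
      Real.log (((m i : ℕ) : ℝ) / (d i : ℝ))))
    (fun S d => (∏ i, (ArithmeticFunction.moebius (d i) : ℝ)) *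
      ∏ i ∈ Finset.univ \ S, Real.log (d i))
    (fun S => (-1 : ℝ) ^ (Finset.univ \ S).card * ∏ i ∈ S, Real.log ((m i : ℕ) : ℝ))
    ((-1 : ℝ) ^ k) hN h0 hS

/-- **Stub `stub_pointwise`.** For `f : Fin k → ℤ[X]`, `y : ℝ`, `n : ℕ` with no `fᵢ(n).toNat = 1`: `(-1)^k` times the route tail summand minus the natural tail summand equals the signed sum over non-empty `S` of `(∏_{i∈S} log fᵢ(n)) · P_S(n, y)`. [folklore] -/
theorem pointwise_expansion' : ∀ (k : ℕ) (f : Fin k → ℤ[X]) (y : ℝ) (n : ℕ),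
    (∀ i, ((f i).eval (n : ℤ)).toNat ≠ 1) →
    (-1 : ℝ) ^ k * (∑ d ∈ Fintype.piFinset (fun i => (((f i).eval (n : ℤ)).toNat).divisors),
        if y < ∏ i, (d i : ℝ) then ∏ i, ((ArithmeticFunction.moebius (d i) : ℝ) * Real.log (d i)) else 0)
      - (∑ d ∈ Fintype.piFinset (fun i => (((f i).eval (n : ℤ)).toNat).divisors),
        if y < ∏ i, (d i : ℝ) then
          ∏ i, ((ArithmeticFunction.moebius (d i) : ℝ) *
            Real.log ((((f i).eval (n : ℤ)).toNat : ℝ) / (d i : ℝ))) else 0)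
    = ∑ S ∈ (Finset.univ : Finset (Fin k)).powerset.filter (fun S => S.Nonempty),
        (-1 : ℝ) ^ (Finset.univ \ S).card * (∏ i ∈ S, Real.log ((((f i).eval (n : ℤ)).toNat : ℝ))) *
          ∑ d ∈ Fintype.piFinset (fun i => (((f i).eval (n : ℤ)).toNat).divisors),
            if ∏ i, (d i : ℝ) ≤ y then
              (∏ i, (ArithmeticFunction.moebius (d i) : ℝ)) * ∏ i ∈ Finset.univ \ S, Real.log (d i)
            else 0 := by
  intro k f y n h
  exact pointwise_nat k (fun i => ((f i).eval (n : ℤ)).toNat) h y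


end PointwiseLocal

/-- (Stub 1, LANDED p86921: pointwise S-expansion.) For a tuple of integer polynomials `f`, a real cut-off `y` and an
argument `n` at which no value `fᵢ(n).toNat` equals `1`, the difference between `(-1)^k` times the
route tail summand and the natural tail summand is the signed sum over non-empty `S ⊆ Fin k` of
`(∏_{i∈S} log fᵢ(n))` times the truncated Type-I sum `P_S(n,y)` carrying a bare `μ(dᵢ)` for `i ∈ S`. -/
theorem pointwise_expansion : ∀ (k : ℕ) (f : Fin k → ℤ[X]) (y : ℝ) (n : ℕ),
    (∀ i, ((f i).eval (n : ℤ)).toNat ≠ 1) →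
    (-1 : ℝ) ^ k * (∑ d ∈ Fintype.piFinset (fun i => (((f i).eval (n : ℤ)).toNat).divisors),
        if y < ∏ i, (d i : ℝ) then ∏ i, ((ArithmeticFunction.moebius (d i) : ℝ) * Real.log (d i)) else 0)
      - (∑ d ∈ Fintype.piFinset (fun i => (((f i).eval (n : ℤ)).toNat).divisors),
        if y < ∏ i, (d i : ℝ) then
          ∏ i, ((ArithmeticFunction.moebius (d i) : ℝ) *
            Real.log ((((f i).eval (n : ℤ)).toNat : ℝ) / (d i : ℝ))) else 0)
    = ∑ S ∈ (Finset.univ : Finset (Fin k)).powerset.filter (fun S => S.Nonempty),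
        (-1 : ℝ) ^ (Finset.univ \ S).card * (∏ i ∈ S, Real.log ((((f i).eval (n : ℤ)).toNat : ℝ))) *
          ∑ d ∈ Fintype.piFinset (fun i => (((f i).eval (n : ℤ)).toNat).divisors),
            if ∏ i, (d i : ℝ) ≤ y then
              (∏ i, (ArithmeticFunction.moebius (d i) : ℝ)) * ∏ i ∈ Finset.univ \ S, Real.log (d i)
            else 0 :=
  PointwiseLocal.pointwise_expansion'

/-- (Stub 2, LANDED p85893: eventual size of the values.) For a Bateman–Horn system every `fᵢ` is non-constant with
positive leading coefficient, so all values `fᵢ(n).toNat` are at least `2` from some point on. -/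
theorem eventually_two_le : ∀ (k : ℕ) (f : Fin k → ℤ[X]),
    Literature.NumberTheory.Sieve.IsBatemanHornSystem f →
      ∃ N : ℕ, ∀ n : ℕ, N ≤ n → ∀ i, 2 ≤ ((f i).eval (n : ℤ)).toNat :=
  Summit.Parity.BatemanHorn.Theorems.PolyMobiusTail.NaturalForm.stub_eventually_two_le

/-- STUB 3a (the analytic KERNEL: truncated signed singular sums with a bare Möbius factor decay at a
log-power rate). For a Bateman–Horn system `f` and a NON-EMPTY `S ⊆ Fin k` there is `C` with
`|V_S(y)| ≤ C/(log y)^{|S|+1}` for `y ≥ 2`, where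
`V_S(y) = Σ_{d ∈ [1,y]^k, ∏ dᵢ ≤ y} (∏ μ(dᵢ)) (∏_{i∉S} log dᵢ) · ρ_f(d)/∏dᵢ` and
`ρ_f(d) = #{n mod ∏dᵢ : dᵢ ∣ fᵢ(n) ∀ i}` is the joint root count (period `∏ dᵢ`).
For `k = 1` this is Landau's 1903 prime ideal theorem in `M`-function form
(`Σ_{d≤y} μ(d)ρ_g(d)/d ≪ (log y)^{-2}`; the tree has the log-Riesz form with de la Vallée-Poussin
rate, `Literature.NumberTheory.LFunctions.abs_logRieszMean_moebius_rootCount_sub_le`); for `k ≥ 2`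
it is the `k`-variable analogue on the hyperbola `∏ dᵢ ≤ y` (a single Dirichlet series
`∏ᵢ ζ_{Kᵢ}(1+s)^{-1}·H(s)` with a zero of order `|S|` at `s = 0`; `pairwise_not_associated` and
`hasNoFixedPrimeDivisor` make `H` analytic and harmless near `0`).

Case k = 1 (Landau's M-form): LANDED p92887 (`…StubKernelFinOne.lean`, over Literature p90535/p92627). -/
theorem kernel_fin_one : ∀ (f : Fin 1 → ℤ[X]),
    Literature.NumberTheory.Sieve.IsBatemanHornSystem f → ∀ S : Finset (Fin 1), S.Nonempty →
      ∃ C : ℝ, ∀ y : ℝ, 2 ≤ y →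
        |∑ d ∈ Fintype.piFinset (fun _ : Fin 1 => Finset.Icc 1 ⌊y⌋₊),
            if ∏ i, (d i : ℝ) ≤ y then
              (∏ i, (ArithmeticFunction.moebius (d i) : ℝ)) * (∏ i ∈ Finset.univ \ S, Real.log (d i)) *
                ((((Finset.range (∏ i, d i)).filter
                    (fun n : ℕ => ∀ i, ((d i : ℕ) : ℤ) ∣ (f i).eval (n : ℤ))).card : ℝ) / ∏ i, (d i : ℝ))
            else 0|
          ≤ C / Real.log y ^ (S.card + 1) :=
  Summit.Parity.BatemanHorn.Theorems.PolyMobiusTail.NaturalForm.stub_kernel_fin_one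

/-! ### v6: the four kernel stubs over the Type-I-main-term apparatus (`𝒶 = 𝓮 ⋆ ∏ 𝒻ᵢ` in `Λ_k`) -/

/-- STUB K1 (`stub_kernel_sum_eq`, identity). Our kernel sum over the box `[1,⌊y⌋]^k ∩ {∏ dᵢ ≤ y}`
with weight `(∏ μ(dᵢ)) (∏_{i∉S} log dᵢ) · #{n < ∏ dᵢ : dᵢ ∣ fᵢ(n) ∀ i}/∏ dᵢ` is the partial sum of the
`[ε_{univ∖S}]`-component of the generating function `𝒶(m) = Σ_{d₁⋯d_k = m} G(d) ∏ᵢ (μ(dᵢ) + εᵢ μ(dᵢ) log dᵢ)`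
(`#{n < ∏dᵢ : …}/∏dᵢ = ρ(d)/lcm d = G(d)` by `card_filter_Ico_mul_sysPred`; regroup by `m = ∏ dᵢ` with
`sum_box_filter_eq_sum_Ioc`; `SAlg.coeff_mul_prod_lin`). [folklore] -/
theorem stub_kernel_sum_eq : ∀ (k : ℕ) (f : Fin k → ℤ[X]) (S : Finset (Fin k)) (y : ℝ), 0 ≤ y →
    (∑ d ∈ Fintype.piFinset (fun _ : Fin k => Finset.Icc 1 ⌊y⌋₊),
      if ∏ i, (d i : ℝ) ≤ y then
        (∏ i, (ArithmeticFunction.moebius (d i) : ℝ)) * (∏ i ∈ Finset.univ \ S, Real.log (d i)) *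
          ((((Finset.range (∏ i, d i)).filter
              (fun n : ℕ => ∀ i, ((d i : ℕ) : ℤ) ∣ (f i).eval (n : ℤ))).card : ℝ) / ∏ i, (d i : ℝ))
      else 0)
    = ∑ m ∈ Finset.Ioc 0 ⌊y⌋₊, Summit.Parity.BatemanHorn.Theorems.TypeIMainTerm.SAlg.coeff (Summit.Parity.BatemanHorn.Theorems.TypeIMainTerm.aFun f m) (Finset.univ \ S) :=
  Summit.Parity.BatemanHorn.Theorems.PolyMobiusTail.NaturalForm.stub_kernel_sum_eq

/-- STUB K2 (`stub_coeff_aFun_eq_sum`, exact identity for every component). From `𝒶 = 𝓮 ⋆ ∏ᵢ 𝒻ᵢ`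
(`aFun_eq_eFun_mul_prod_fFun`) and `SAlg.coeff_mul_prod_lin`:
`[ε_T] 𝒶(m) = Σ_{J ⊆ T} ([ε_{T∖J}] 𝓮 ⋆ F_J)(m)`, `F_J = ∏ᵢ (μ gᵢ log if i ∈ J, else μ gᵢ)`; the tree has
the case `T = univ` (`coeff_univ_aFun_eq_sum`). [folklore] -/
theorem stub_coeff_aFun_eq_sum : ∀ (k : ℕ) (f : Fin k → ℤ[X]) (T : Finset (Fin k)) (m : ℕ),
    Summit.Parity.BatemanHorn.Theorems.TypeIMainTerm.SAlg.coeff (Summit.Parity.BatemanHorn.Theorems.TypeIMainTerm.aFun f m) T =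
      ∑ J ∈ T.powerset, (Summit.Parity.BatemanHorn.Theorems.TypeIMainTerm.compE f (Finset.univ \ (T \ J)) * Summit.Parity.BatemanHorn.Theorems.TypeIMainTerm.compF f J) m :=
  Summit.Parity.BatemanHorn.Theorems.PolyMobiusTail.NaturalForm.stub_coeff_aFun_eq_sum

/-- STUB K3 (`stub_eFun_logpow_summable`, Euler control with logarithms). For irreducible, pairwise
non-associated `fᵢ` with `ρ_{fᵢ}(p) < p`: `Σ_n ‖𝓮(n)‖ (1 + log n)^B < ∞` for every `B` — the proof of the
tree's `summable_norm1_eFun` (`B = 0`) with the sub-multiplicative weight `(1 + log n)^B`: at every prime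
the local series still converges (`norm1_eFun_prime_pow_le`, ratio `1 − 1/p`), `𝓮(p) = 0`, and at good
primes the tail is `≪ (1 + log p)^{k+1+B}/p²` (`norm1_eFun_prime_pow_le_of_good`). [folklore] -/
theorem stub_eFun_logpow_summable : ∀ (k : ℕ) (f : Fin k → ℤ[X]),
    (∀ i, Irreducible (f i)) → (Pairwise fun i j => ¬Associated (f i) (f j)) →
    (∀ i p, p.Prime → Literature.NumberTheory.Sieve.polyRootCountMod ![f i] p < p) → ∀ B : ℕ,
    Summable (fun n : ℕ => Summit.Parity.BatemanHorn.Theorems.TypeIMainTerm.SAlg.norm1 (Summit.Parity.BatemanHorn.Theorems.TypeIMainTerm.eFun f n) * (1 + Real.log n) ^ B) :=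
  Summit.Parity.BatemanHorn.Theorems.PolyMobiusTail.NaturalForm.stub_eFun_logpow_summable

/-- STUB K4 (`stub_conv_rate`, abstract). If `Σ_n |e(n)| (1 + log n)^B ≤ E`, the partial sums of `F`
are `≤ K/(1 + log N)^A` in absolute value and `Σ_{n≤N} |F(n)| ≤ M (1 + log N)^a`, then
`|Σ_{n≤N} (e ⋆ F)(n)| ≤ 4^A E K/(1 + log N)^A + 4^B E M (1 + log N)^a/(1 + log N)^B`
(`Σ_{n≤N} (e⋆F)(n) = Σ_{m≤N} e(m) 𝔉(N/m)`; split at `m ≤ ⌊√N⌋`, where `1 + log(N/m) ≥ (1 + log N)/4`,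
and `m > ⌊√N⌋`, where `Σ_{m>√N} |e(m)| ≤ 2^B E/(1 + log N)^B`). [folklore] -/
theorem stub_conv_rate : ∀ (e F : ArithmeticFunction ℝ) (E K M : ℝ) (A B a : ℕ),
    0 ≤ E → 0 ≤ K → 0 ≤ M →
    (∀ N : ℕ, ∑ n ∈ Finset.Ioc 0 N, |e n| * (1 + Real.log n) ^ B ≤ E) →
    (∀ N : ℕ, 1 ≤ N → |∑ n ∈ Finset.Ioc 0 N, F n| ≤ K / (1 + Real.log N) ^ A) →
    (∀ N : ℕ, 1 ≤ N → ∑ n ∈ Finset.Ioc 0 N, |F n| ≤ M * (1 + Real.log N) ^ a) →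
    ∀ N : ℕ, 1 ≤ N → |∑ n ∈ Finset.Ioc 0 N, (e * F) n| ≤
      (4 : ℝ) ^ A * E * K / (1 + Real.log N) ^ A +
        (4 : ℝ) ^ B * E * M * (1 + Real.log N) ^ a / (1 + Real.log N) ^ B :=
  Summit.Parity.BatemanHorn.Theorems.PolyMobiusTail.NaturalForm.stub_conv_rate

/-! ### v7: kernel assembly LANDED (`Theorems/IsogenyRedeiPolyMobiusTailKernelTwoLe.lean`) -/

/-- STUB 3a″ (`stub_kernel_two_le`, k ≥ 2: the `k`-variable hyperbolic kernel). v6: ASSEMBLED by the lead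
from stubs K1–K4 and the tree (`hasLogRate_prod`, `mg_mgl_rate`, `mg_mgl_variation`): for `S ≠ ∅` every
`J ⊆ univ ∖ S` misses some coordinate, so `F_J` has partial sums `→ 0` at any prescribed log-power rate. -/
theorem stub_kernel_two_le : ∀ (k : ℕ), 2 ≤ k → ∀ (f : Fin k → ℤ[X]),
    Literature.NumberTheory.Sieve.IsBatemanHornSystem f → ∀ S : Finset (Fin k), S.Nonempty →
      ∃ C : ℝ, ∀ y : ℝ, 2 ≤ y →
        |∑ d ∈ Fintype.piFinset (fun _ : Fin k => Finset.Icc 1 ⌊y⌋₊),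
            if ∏ i, (d i : ℝ) ≤ y then
              (∏ i, (ArithmeticFunction.moebius (d i) : ℝ)) * (∏ i ∈ Finset.univ \ S, Real.log (d i)) *
                ((((Finset.range (∏ i, d i)).filter
                    (fun n : ℕ => ∀ i, ((d i : ℕ) : ℤ) ∣ (f i).eval (n : ℤ))).card : ℝ) / ∏ i, (d i : ℝ))
            else 0|
          ≤ C / Real.log y ^ (S.card + 1) :=
  Summit.Parity.BatemanHorn.Theorems.PolyMobiusTail.NaturalForm.stub_kernel_two_le

/-- The kernel bound for every `k` (cases `k = 0`: no non-empty `S`; `k = 1`: stub 3a′; `k ≥ 2`: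
stub 3a″). -/
theorem kernel_bound : ∀ (k : ℕ) (f : Fin k → ℤ[X]),
    Literature.NumberTheory.Sieve.IsBatemanHornSystem f → ∀ S : Finset (Fin k), S.Nonempty →
      ∃ C : ℝ, ∀ y : ℝ, 2 ≤ y →
        |∑ d ∈ Fintype.piFinset (fun _ : Fin k => Finset.Icc 1 ⌊y⌋₊),
            if ∏ i, (d i : ℝ) ≤ y then
              (∏ i, (ArithmeticFunction.moebius (d i) : ℝ)) * (∏ i ∈ Finset.univ \ S, Real.log (d i)) *
                ((((Finset.range (∏ i, d i)).filter
                    (fun n : ℕ => ∀ i, ((d i : ℕ) : ℤ) ∣ (f i).eval (n : ℤ))).card : ℝ) / ∏ i, (d i : ℝ))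
            else 0|
          ≤ C / Real.log y ^ (S.card + 1) := by
  intro k
  rcases k with _ | _ | k
  · intro f _ S hS
    exact absurd hS (by simp [Finset.eq_empty_of_isEmpty S])
  · exact kernel_fin_one
  · exact stub_kernel_two_le (k + 2) (by omega)

/-- (Stub 3b, LANDED p92884: bookkeeping — signed Type-I sums from the kernel.) GIVEN the kernel bound of stub 3a, for
a Bateman–Horn system, `η ∈ (1/2, 1)` and a NON-EMPTY `S ⊆ Fin k`:
`Σ_{n ≤ x} (∏_{i∈S} log fᵢ(n)) · Σ_{dᵢ ∣ fᵢ(n), ∏ dᵢ ≤ x^{1-η}} (∏ μ(dᵢ)) ∏_{i∉S} log dᵢ = o(x)`.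
(Swap the sums; `n ↦ [dᵢ ∣ fᵢ(n) ∀i]` has period `∏ dᵢ ≤ y = x^{1-η}` with `ρ_f(d)` solutions per
period, so the smooth weight `∏_{i∈S} log fᵢ(n)` (eventually monotone) sums over the solutions to
`(ρ_f(d)/∏dᵢ)·X_S(x) + O(ρ_f(d)·(log x)^{|S|})`, `X_S(x) = Σ_{n≤x} ∏_{i∈S} log fᵢ(n) ≪ x (log x)^{|S|}`;
the error terms total `O(y²(log y)^k (log x)^{|S|}) = o(x)` because `η > 1/2` (`ρ_f(d) ≤ ∏ dᵢ ≤ y`,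
`#{d : ∏dᵢ ≤ y} ≤ y(1 + log y)^{k-1}`), and the main term is `X_S(x)·V_S(y) ≪ x (log x)^{|S|} ·
(log y)^{-|S|-1} = O(x/log x)`.) -/
theorem signedTypeI_of_kernel :
    (∀ (k : ℕ) (f : Fin k → ℤ[X]),
      Literature.NumberTheory.Sieve.IsBatemanHornSystem f → ∀ S : Finset (Fin k), S.Nonempty →
        ∃ C : ℝ, ∀ y : ℝ, 2 ≤ y →
          |∑ d ∈ Fintype.piFinset (fun _ : Fin k => Finset.Icc 1 ⌊y⌋₊),
              if ∏ i, (d i : ℝ) ≤ y then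
                (∏ i, (ArithmeticFunction.moebius (d i) : ℝ)) * (∏ i ∈ Finset.univ \ S, Real.log (d i)) *
                  ((((Finset.range (∏ i, d i)).filter
                      (fun n : ℕ => ∀ i, ((d i : ℕ) : ℤ) ∣ (f i).eval (n : ℤ))).card : ℝ) / ∏ i, (d i : ℝ))
              else 0|
            ≤ C / Real.log y ^ (S.card + 1)) →
    ∀ (k : ℕ) (f : Fin k → ℤ[X]),
      Literature.NumberTheory.Sieve.IsBatemanHornSystem f → ∀ η : ℝ, 1 / 2 < η → η < 1 →
        ∀ S : Finset (Fin k), S.Nonempty →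
          (fun x : ℕ => ∑ n ∈ Finset.Icc 1 x,
            (∏ i ∈ S, Real.log ((((f i).eval (n : ℤ)).toNat : ℝ))) *
              ∑ d ∈ Fintype.piFinset (fun i => (((f i).eval (n : ℤ)).toNat).divisors),
                if ∏ i, (d i : ℝ) ≤ (x : ℝ) ^ (1 - η) then
                  (∏ i, (ArithmeticFunction.moebius (d i) : ℝ)) * ∏ i ∈ Finset.univ \ S, Real.log (d i)
                else 0)
          =o[atTop] fun x : ℕ => (x : ℝ) :=
  Summit.Parity.BatemanHorn.Theorems.PolyMobiusTail.NaturalForm.stub_signedTypeI_of_kernel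

/-- Signed Type-I sums with a bare Möbius factor are `o(x)` (stub 3b applied to stub 3a). -/
theorem signedTypeI_isLittleO : ∀ (k : ℕ) (f : Fin k → ℤ[X]),
    Literature.NumberTheory.Sieve.IsBatemanHornSystem f → ∀ η : ℝ, 1 / 2 < η → η < 1 →
      ∀ S : Finset (Fin k), S.Nonempty →
        (fun x : ℕ => ∑ n ∈ Finset.Icc 1 x,
          (∏ i ∈ S, Real.log ((((f i).eval (n : ℤ)).toNat : ℝ))) *
            ∑ d ∈ Fintype.piFinset (fun i => (((f i).eval (n : ℤ)).toNat).divisors),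
              if ∏ i, (d i : ℝ) ≤ (x : ℝ) ^ (1 - η) then
                (∏ i, (ArithmeticFunction.moebius (d i) : ℝ)) * ∏ i ∈ Finset.univ \ S, Real.log (d i)
              else 0)
        =o[atTop] fun x : ℕ => (x : ℝ) :=
  signedTypeI_of_kernel kernel_bound

/-- (Stub 4′, LANDED as `…StubStripFinOne{A,B,C,}.lean`: the Type-I-trivial strip, case `k = 1`.) For a one-member Bateman–Horn system and `η ∈ (1/2, 1)` the
natural tail between the cut-offs `x^{1-η}` and `x/(log x)^4` sums to `o(x)`. -/
theorem stub_strip_fin_one : ∀ (f : Fin 1 → ℤ[X]),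
    Literature.NumberTheory.Sieve.IsBatemanHornSystem f → ∀ η : ℝ, 1 / 2 < η → η < 1 →
      (fun x : ℕ => ∑ n ∈ Finset.Icc 1 x,
        ((∑ d ∈ Fintype.piFinset (fun i => (((f i).eval (n : ℤ)).toNat).divisors),
            if (x : ℝ) ^ (1 - η) < ∏ i, (d i : ℝ) then
              ∏ i, ((ArithmeticFunction.moebius (d i) : ℝ) *
                Real.log ((((f i).eval (n : ℤ)).toNat : ℝ) / (d i : ℝ))) else 0)
        - (∑ d ∈ Fintype.piFinset (fun i => (((f i).eval (n : ℤ)).toNat).divisors),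
            if (x : ℝ) / Real.log x ^ (2 * 1 + 2) < ∏ i, (d i : ℝ) then
              ∏ i, ((ArithmeticFunction.moebius (d i) : ℝ) *
                Real.log ((((f i).eval (n : ℤ)).toNat : ℝ) / (d i : ℝ))) else 0)))
        =o[atTop] fun x : ℕ => (x : ℝ) :=
  Summit.Parity.BatemanHorn.Theorems.PolyMobiusTail.NaturalForm.stub_strip_fin_one

/-! ### v6: the two strip stubs -/

/-- STUB S1 (`stub_strip_core`, swap + period with the EXACT root-count error, every `T ⊆ Fin k`). Beyond a
threshold `N₀ ≥ 3` past which all values are `≥ 2` and non-decreasing, for `x ≥ N₀` and `y ≥ 1`: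
`Σ_{N₀≤n≤x} (∏_{i∈T} log fᵢ(n)) P_T(n,y) = (Σ_{N₀≤n≤x} ∏_{i∈T} log fᵢ(n)) · V_T(y) + O((log x)^{|T|} (1 + log y)^{k-|T|}
Σ_{d ∈ box, ∏dᵢ ≤ y} μ²(d) #{r < ∏dᵢ : dᵢ ∣ fᵢ(r)})` — `core_estimate` + `signedTypeI_divisor_sum_eq` of the
landed `…StubSignedTypeIOfKernel{,Aux}` with the coefficient bound `|∏μ(dᵢ) ∏_{i∉T} log dᵢ| ≤ μ²(d)(1 + log y)^{k-|T|}`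
and `∏_{i∈T} log fᵢ(x) ≤ (K log x)^{|T|}` (`signedTypeI_log_toNat_eval_le`). [folklore] -/
theorem stub_strip_core : ∀ (k : ℕ) (f : Fin k → ℤ[X]) (T : Finset (Fin k)) (N₀ : ℕ), 3 ≤ N₀ →
    (∀ n : ℕ, N₀ ≤ n → ∀ i, 2 ≤ ((f i).eval (n : ℤ)).toNat) →
    (∀ i (m n : ℕ), N₀ ≤ m → m ≤ n → (f i).eval (m : ℤ) ≤ (f i).eval (n : ℤ)) →
    ∃ C : ℝ, ∀ x : ℕ, N₀ ≤ x → ∀ y : ℝ, 1 ≤ y →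
      |(∑ n ∈ Finset.Icc N₀ x, (∏ i ∈ T, Real.log ((((f i).eval (n : ℤ)).toNat : ℝ))) *
          ∑ d ∈ Fintype.piFinset (fun i => (((f i).eval (n : ℤ)).toNat).divisors),
            if ∏ i, (d i : ℝ) ≤ y then
              (∏ i, (ArithmeticFunction.moebius (d i) : ℝ)) * ∏ i ∈ Finset.univ \ T, Real.log (d i)
            else 0)
        - (∑ n ∈ Finset.Icc N₀ x, ∏ i ∈ T, Real.log ((((f i).eval (n : ℤ)).toNat : ℝ))) *
          ∑ d ∈ Fintype.piFinset (fun _ : Fin k => Finset.Icc 1 ⌊y⌋₊),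
            if ∏ i, (d i : ℝ) ≤ y then
              (∏ i, (ArithmeticFunction.moebius (d i) : ℝ)) * (∏ i ∈ Finset.univ \ T, Real.log (d i)) *
                ((((Finset.range (∏ i, d i)).filter
                    (fun n : ℕ => ∀ i, ((d i : ℕ) : ℤ) ∣ (f i).eval (n : ℤ))).card : ℝ) / ∏ i, (d i : ℝ))
            else 0|
      ≤ C * Real.log x ^ T.card * (1 + Real.log y) ^ (Finset.univ \ T).card *
          ∑ d ∈ Fintype.piFinset (fun _ : Fin k => Finset.Icc 1 ⌊y⌋₊),
            if ∏ i, (d i : ℝ) ≤ y then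
              (∏ i, |(ArithmeticFunction.moebius (d i) : ℝ)|) *
                (((Finset.range (∏ i, d i)).filter
                    (fun n : ℕ => ∀ i, ((d i : ℕ) : ℤ) ∣ (f i).eval (n : ℤ))).card : ℝ)
            else 0 :=
  Summit.Parity.BatemanHorn.Theorems.PolyMobiusTail.NaturalForm.stub_strip_core

/-- STUB S2 (`stub_tuple_rootCount_mean`, tuple root-count mean value). For a Bateman–Horn system:
`Σ_{d ∈ [1,⌊y⌋]^k, ∏dᵢ ≤ y} μ²(d) · #{r < ∏dᵢ : dᵢ ∣ fᵢ(r) ∀ i} ≤ C y (log y)^k` for `y ≥ 2`. The summand is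
multiplicative on tuples with coprime products (`card_filter_range_mul_of_periodic`), so its push-forward to
`m = ∏ dᵢ` is multiplicative (`isMultiplicative_pushforward`); at a good prime `p > P₀`
(`exists_forall_not_dvd_eval_and_dvd_eval`) only the `k` tuples `p·eᵢ` survive, with value `ρ_{fᵢ}(p)`
(`sysCount_mulSingle`), at the finitely many bad primes the local factor is a constant; the Euler majorant
(`sum_le_prod_tsum_of_submultiplicative` for `h(m)/m`) and Mertens for `ρ_{fᵢ}`
(`exists_sum_primesLE_rootCount_div_le`) give `Σ_{m≤y} h(m)/m ≪ (log y)^k`. [folklore] -/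
theorem stub_tuple_rootCount_mean : ∀ (k : ℕ) (f : Fin k → ℤ[X]),
    Literature.NumberTheory.Sieve.IsBatemanHornSystem f →
    ∃ C : ℝ, ∀ y : ℝ, 2 ≤ y →
      ∑ d ∈ Fintype.piFinset (fun _ : Fin k => Finset.Icc 1 ⌊y⌋₊),
        (if ∏ i, (d i : ℝ) ≤ y then
          (∏ i, |(ArithmeticFunction.moebius (d i) : ℝ)|) *
            (((Finset.range (∏ i, d i)).filter
                (fun n : ℕ => ∀ i, ((d i : ℕ) : ℤ) ∣ (f i).eval (n : ℤ))).card : ℝ)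
        else 0)
      ≤ C * y * Real.log y ^ k :=
  Summit.Parity.BatemanHorn.Theorems.PolyMobiusTail.NaturalForm.stub_tuple_rootCount_mean

/-- STUB 4″ (`stub_strip_two_le`, the strip, case `k ≥ 2`). v6: ASSEMBLED by the lead from `stub_strip_core`,
`stub_tuple_rootCount_mean`, the kernel (`T ≠ ∅`) and the convergence of the log-weighted singular series
(`T = ∅`: `x · (V_∅(x/(log x)^{2k+2}) − V_∅(x^{1-η})) = o(x)`, tree `tendsto_sum_coeff_univ_aFun` through
`stub_kernel_sum_eq`); the error at the upper cut-off is `≪ (log x)^k · x (log x)^{k − (2k+2)} = x/(log x)²`. -/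
theorem stub_strip_two_le : ∀ (k : ℕ), 2 ≤ k → ∀ (f : Fin k → ℤ[X]),
    Literature.NumberTheory.Sieve.IsBatemanHornSystem f → ∀ η : ℝ, 1 / 2 < η → η < 1 →
      (fun x : ℕ => ∑ n ∈ Finset.Icc 1 x,
        ((∑ d ∈ Fintype.piFinset (fun i => (((f i).eval (n : ℤ)).toNat).divisors),
            if (x : ℝ) ^ (1 - η) < ∏ i, (d i : ℝ) then
              ∏ i, ((ArithmeticFunction.moebius (d i) : ℝ) *
                Real.log ((((f i).eval (n : ℤ)).toNat : ℝ) / (d i : ℝ))) else 0)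
        - (∑ d ∈ Fintype.piFinset (fun i => (((f i).eval (n : ℤ)).toNat).divisors),
            if (x : ℝ) / Real.log x ^ (2 * k + 2) < ∏ i, (d i : ℝ) then
              ∏ i, ((ArithmeticFunction.moebius (d i) : ℝ) *
                Real.log ((((f i).eval (n : ℤ)).toNat : ℝ) / (d i : ℝ))) else 0)))
        =o[atTop] fun x : ℕ => (x : ℝ) :=
  Summit.Parity.BatemanHorn.Theorems.PolyMobiusTail.NaturalForm.stub_strip_two_le

/-- The strip for every `k ≥ 1` (cases `k = 1`: stub 4′; `k ≥ 2`: stub 4″). -/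
theorem strip_bound : ∀ (k : ℕ), 1 ≤ k → ∀ (f : Fin k → ℤ[X]),
    Literature.NumberTheory.Sieve.IsBatemanHornSystem f → ∀ η : ℝ, 1 / 2 < η → η < 1 →
      (fun x : ℕ => ∑ n ∈ Finset.Icc 1 x,
        ((∑ d ∈ Fintype.piFinset (fun i => (((f i).eval (n : ℤ)).toNat).divisors),
            if (x : ℝ) ^ (1 - η) < ∏ i, (d i : ℝ) then
              ∏ i, ((ArithmeticFunction.moebius (d i) : ℝ) *
                Real.log ((((f i).eval (n : ℤ)).toNat : ℝ) / (d i : ℝ))) else 0)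
        - (∑ d ∈ Fintype.piFinset (fun i => (((f i).eval (n : ℤ)).toNat).divisors),
            if (x : ℝ) / Real.log x ^ (2 * k + 2) < ∏ i, (d i : ℝ) then
              ∏ i, ((ArithmeticFunction.moebius (d i) : ℝ) *
                Real.log ((((f i).eval (n : ℤ)).toNat : ℝ) / (d i : ℝ))) else 0)))
        =o[atTop] fun x : ℕ => (x : ℝ) := by
  intro k hk
  rcases k with _ | _ | k
  · omega
  · exact stub_strip_fin_one
  · exact stub_strip_two_le (k + 2) (by omega)

/-- STUB 5 (C⁺, held by the lead: the natural tail beyond the LOG cut-off). For a Bateman–Horn system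
the natural tail beyond `x/(log x)^{2k+2}` sums to `o(x)`. Equivalent to the crux modulo stubs 1–4
(the parity content of Bateman–Horn lives here). -/
theorem stub_naturalLogTail : ∀ (k : ℕ) (f : Fin k → ℤ[X]),
    Literature.NumberTheory.Sieve.IsBatemanHornSystem f →
      (fun x : ℕ => ∑ n ∈ Finset.Icc 1 x,
        ∑ d ∈ Fintype.piFinset (fun i => (((f i).eval (n : ℤ)).toNat).divisors),
          if (x : ℝ) / Real.log x ^ (2 * k + 2) < ∏ i, (d i : ℝ) then
            ∏ i, ((ArithmeticFunction.moebius (d i) : ℝ) *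
              Real.log ((((f i).eval (n : ℤ)).toNat : ℝ) / (d i : ℝ))) else 0)
        =o[atTop] fun x : ℕ => (x : ℝ) := by
  sorry

/-! ### v8.1-local: byte-identical local copy of the LANDED proof of `stub_degreeOneSlice`
(p114749, `Theorems/IsogenyRedeiPolyMobiusTailStubDegreeOneSlice.lean`; the tree module is not yet built on the
farm, so it cannot be imported here — exactly as v5–v7 did for stub 1). Helpers under `DegreeOneLocal`. -/

namespace DegreeOneLocal

/-! ### The linear polynomial behind a degree-one system -/

section Shape

variable {f : Fin 1 → ℤ[X]}

/-- A degree-one polynomial evaluates as `q·n + a` with `q` its leading coefficient and `a` its constant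
term. [folklore] -/
theorem eval_eq (hdeg : (f 0).natDegree = 1) (n : ℤ) :
    (f 0).eval n = (f 0).leadingCoeff * n + (f 0).coeff 0 := by
  have h := eq_X_add_C_of_natDegree_le_one (p := f 0) hdeg.le
  have hlc : (f 0).leadingCoeff = (f 0).coeff 1 := by rw [leadingCoeff, hdeg]
  conv_lhs => rw [h]
  rw [eval_add, eval_mul, eval_C, eval_X, eval_C, hlc]

/-- The product over `Fin 1` of the values is the single value `q·n + a`. [folklore] -/
theorem prod_eval_eq (hdeg : (f 0).natDegree = 1) (n : ℤ) :
    ∏ i, (f i).eval n = (f 0).leadingCoeff * n + (f 0).coeff 0 := by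
  rw [Fin.prod_univ_one, eval_eq hdeg]

/-- No fixed prime divisor forces `gcd(q, a) = 1`: a prime dividing the leading coefficient does not
divide the constant term. [folklore] -/
theorem not_dvd_coeff_zero (hf : IsBatemanHornSystem f) (hdeg : (f 0).natDegree = 1) {p : ℕ}
    (hp : p.Prime) (hpq : (p : ℤ) ∣ (f 0).leadingCoeff) : ¬ (p : ℤ) ∣ (f 0).coeff 0 := by
  intro hpa
  have hlt := hf.hasNoFixedPrimeDivisor p hp
  unfold polyRootCountMod at hlt
  have hall : ((range p).filter fun n : ℕ => (p : ℤ) ∣ ∏ i, (f i).eval (n : ℤ)) = range p := by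
    refine Finset.filter_true_of_mem fun n _ => ?_
    rw [prod_eval_eq hdeg]
    exact (hpq.mul_right _).add hpa
  rw [hall, card_range] at hlt
  exact lt_irrefl _ hlt

/-- `ω_f(p)` for a degree-one Bateman–Horn system `(qX + a)`: no root modulo `p ∣ q` (as then `p ∤ a`),
exactly one root modulo `p ∤ q`. [folklore] -/
theorem polyRootCountMod_eq (hf : IsBatemanHornSystem f) (hdeg : (f 0).natDegree = 1) {p : ℕ}
    (hp : p.Prime) : polyRootCountMod f p = if (p : ℤ) ∣ (f 0).leadingCoeff then 0 else 1 := by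
  haveI := Fact.mk hp
  set q : ℤ := (f 0).leadingCoeff with hq
  set a : ℤ := (f 0).coeff 0 with ha
  unfold polyRootCountMod
  have hcast : ∀ n : ℕ, ((p : ℤ) ∣ ∏ i, (f i).eval (n : ℤ)) ↔ ((q : ZMod p) * n + (a : ZMod p) = 0) := by
    intro n
    rw [prod_eval_eq hdeg, ← ZMod.intCast_zmod_eq_zero_iff_dvd]
    push_cast
    rfl
  simp_rw [hcast]
  split_ifs with hpq
  · rw [card_eq_zero, filter_eq_empty_iff]
    intro n _ h0
    rw [(ZMod.intCast_zmod_eq_zero_iff_dvd q p).mpr hpq, zero_mul, zero_add,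
      ZMod.intCast_zmod_eq_zero_iff_dvd] at h0
    exact not_dvd_coeff_zero hf hdeg hp hpq h0
  · have hq0 : (q : ZMod p) ≠ 0 := by rwa [Ne, ZMod.intCast_zmod_eq_zero_iff_dvd]
    set r : ZMod p := -(a : ZMod p) / q with hr
    have hset : (range p).filter (fun n : ℕ => (q : ZMod p) * n + a = 0) = {r.val} := by
      ext n
      simp only [mem_filter, mem_range, mem_singleton]
      constructor
      · rintro ⟨hn, h0⟩
        have : (n : ZMod p) = r := by
          rw [hr, eq_div_iff hq0]
          linear_combination h0
        rw [← this, ZMod.val_natCast, Nat.mod_eq_of_lt hn]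
      · rintro rfl
        refine ⟨ZMod.val_lt r, ?_⟩
        rw [ZMod.natCast_zmod_val, hr]
        field_simp
        ring
    rw [hset, card_singleton]

/-- The leading coefficient of a Bateman–Horn member, as a natural number, is positive and casts back.
[folklore] -/
theorem leadingCoeff_toNat (hf : IsBatemanHornSystem f) :
    0 < (f 0).leadingCoeff.toNat ∧ (((f 0).leadingCoeff.toNat : ℕ) : ℤ) = (f 0).leadingCoeff := by
  have hq : 0 < (f 0).leadingCoeff := hf.leadingCoeff_pos 0
  exact ⟨by omega, Int.toNat_of_nonneg hq.le⟩

/-- The ordered Bateman–Horn partial products of a degree-one system are eventually the finite product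
`∏_{p ∣ q} (1 - 1/p)⁻¹ = q/φ(q)`. [folklore] -/
theorem batemanHornPartial_eq (hf : IsBatemanHornSystem f) (hdeg : (f 0).natDegree = 1) {x : ℕ}
    (hx : (f 0).leadingCoeff.toNat ≤ x) :
    batemanHornPartial f x =
      ((f 0).leadingCoeff.toNat : ℝ) / Nat.totient (f 0).leadingCoeff.toNat := by
  obtain ⟨hQpos, hQq⟩ := leadingCoeff_toNat hf
  set Q : ℕ := (f 0).leadingCoeff.toNat with hQ
  rw [← prod_primeFactors_inv_eq_div_totient hQpos]
  unfold batemanHornPartial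
  rw [Fintype.card_fin]
  have h1 : ∀ p ∈ Nat.primesLE x, (1 - 1 / (p : ℝ))⁻¹ ^ 1 *
      (1 - (polyRootCountMod f p : ℝ) / p) = if p ∣ Q then (1 - 1 / (p : ℝ))⁻¹ else 1 := by
    intro p hp
    have hpp := (Nat.mem_primesLE.mp hp).2
    have hdvd : ((p : ℤ) ∣ (f 0).leadingCoeff) ↔ p ∣ Q := by
      rw [← hQq, Int.natCast_dvd_natCast]
    rw [polyRootCountMod_eq hf hdeg hpp, pow_one]
    by_cases h : p ∣ Q
    · rw [if_pos (hdvd.mpr h), if_pos h]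
      simp
    · rw [if_neg (mt hdvd.mp h), if_neg h]
      have hp0 : (0 : ℝ) < p := by exact_mod_cast hpp.pos
      have hne : (1 : ℝ) - 1 / p ≠ 0 := by
        rw [sub_ne_zero, ne_comm, ne_eq, div_eq_one_iff_eq hp0.ne']
        have : (1 : ℝ) < p := by exact_mod_cast hpp.one_lt
        linarith
      push_cast
      rw [inv_mul_cancel₀ hne]
  rw [prod_congr rfl h1, prod_ite, prod_const_one, mul_one]
  refine prod_congr ?_ fun _ _ => rfl
  ext p
  simp only [mem_filter, Nat.mem_primesLE, Nat.mem_primeFactors, ne_eq]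
  constructor
  · rintro ⟨⟨-, hp⟩, hpa⟩
    exact ⟨hp, hpa, hQpos.ne'⟩
  · rintro ⟨hp, hpa, -⟩
    exact ⟨⟨(Nat.le_of_dvd hQpos hpa).trans hx, hp⟩, hpa⟩

/-- The Bateman–Horn constant of a degree-one system `(qX + a)` is `q/φ(q)` (ordered limit of an eventually
constant sequence). [folklore] -/
theorem hasBatemanHornConst (hf : IsBatemanHornSystem f) (hdeg : (f 0).natDegree = 1) :
    HasBatemanHornConst f (((f 0).leadingCoeff.toNat : ℝ) / Nat.totient (f 0).leadingCoeff.toNat) := by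
  unfold HasBatemanHornConst
  refine tendsto_const_nhds.congr' ?_
  filter_upwards [eventually_ge_atTop (f 0).leadingCoeff.toNat] with x hx
  exact (batemanHornPartial_eq hf hdeg hx).symm

end Shape

/-! ### `Λ` along an arithmetic progression: the sampling identity and its asymptotic -/

section Lambda

variable (q a : ℤ)

/-- One step of the sampling identity: between `(qx + a)⁺` and `(q(x+1) + a)⁺` the only integer
`≡ a (mod q)` carrying a `Λ` is `q(x+1) + a` itself (when positive). [folklore] -/
theorem sum_Ioc_residueClass_step (hq : 0 < q) (x : ℕ) :
    ∑ m ∈ Ioc (q * x + a).toNat (q * (x + 1) + a).toNat,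
        ArithmeticFunction.vonMangoldt.residueClass (a : ZMod q.toNat) m
      = ArithmeticFunction.vonMangoldt (q * (x + 1) + a).toNat := by
  set Q : ℕ := q.toNat with hQ
  have hQq : (Q : ℤ) = q := Int.toNat_of_nonneg hq.le
  by_cases hN : q * (x + 1) + a ≤ 0
  · -- nothing to count
    have h0 : (q * (x + 1) + a).toNat = 0 := Int.toNat_eq_zero.mpr hN
    rw [h0]
    simp
  push Not at hN
  set N : ℕ := (q * (x + 1) + a).toNat with hNdef
  have hNZ : (N : ℤ) = q * (x + 1) + a := Int.toNat_of_nonneg hN.le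
  have hN1 : 1 ≤ N := by omega
  -- the top index
  have htop : (q * x + a).toNat ≤ N - 1 := by
    have : ((q * x + a).toNat : ℤ) ≤ (N : ℤ) - 1 := by
      rcases le_or_gt 0 (q * x + a) with h | h
      · rw [Int.toNat_of_nonneg h]; nlinarith
      · rw [Int.toNat_eq_zero.mpr h.le]; push_cast; omega
    omega
  have hsplit : Ioc (q * x + a).toNat N = Ioc (q * x + a).toNat (N - 1 + 1) := by
    rw [Nat.sub_add_cancel hN1]
  rw [hsplit, sum_Ioc_succ_top htop, Nat.sub_add_cancel hN1]
  -- the intermediate terms vanish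
  have hmid : ∑ m ∈ Ioc (q * x + a).toNat (N - 1),
      ArithmeticFunction.vonMangoldt.residueClass (a : ZMod Q) m = 0 := by
    refine sum_eq_zero fun m hm => ?_
    obtain ⟨hm1, hm2⟩ := mem_Ioc.mp hm
    simp only [ArithmeticFunction.vonMangoldt.residueClass, Set.indicator_apply_eq_zero,
      Set.mem_setOf_eq]
    intro hma
    exfalso
    -- `Q ∣ N - m` with `0 < N - m < Q`
    have hdvd : (Q : ℤ) ∣ (N : ℤ) - m := by
      rw [← ZMod.intCast_zmod_eq_zero_iff_dvd]
      push_cast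
      rw [hma, ← Int.cast_natCast (R := ZMod Q) N, hNZ]
      push_cast
      rw [← hQq]
      push_cast
      rw [ZMod.natCast_self, zero_mul, zero_add, sub_self]
    have hlow : ((q * x + a).toNat : ℤ) ≥ q * x + a := Int.self_le_toNat _
    have h1 : (0 : ℤ) < (N : ℤ) - m := by omega
    have h2 : (N : ℤ) - m < Q := by
      rw [hQq]
      have : ((q * x + a).toNat : ℤ) < m := by exact_mod_cast hm1
      have hmul : q * ((x : ℤ) + 1) = q * x + q := by ring
      omega
    obtain ⟨c, hc⟩ := hdvd
    have hQpos : (0 : ℤ) < Q := by rw [hQq]; exact hq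
    have hc1 : 0 < c := by
      by_contra hc0; push Not at hc0
      have : (Q : ℤ) * c ≤ 0 := mul_nonpos_of_nonneg_of_nonpos hQpos.le hc0
      omega
    have : (Q : ℤ) * 1 ≤ (Q : ℤ) * c := mul_le_mul_of_nonneg_left hc1 hQpos.le
    omega
  rw [hmid, zero_add]
  -- the top term is `Λ(N)` since `N ≡ a (mod q)`
  simp only [ArithmeticFunction.vonMangoldt.residueClass, Set.indicator_apply, Set.mem_setOf_eq]
  rw [if_pos]
  have : ((N : ℕ) : ZMod Q) = ((N : ℤ) : ZMod Q) := by push_cast; rfl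
  rw [this, hNZ, ← hQq]
  push_cast
  rw [ZMod.natCast_self, zero_mul, zero_add]

/-- **Sampling identity.** For `q ≥ 1`, `a ∈ ℤ` and every `x`:
`Σ_{1 ≤ n ≤ x} Λ((qn + a)⁺) = ψ((qx + a)⁺; q, a) - ψ(a⁺; q, a)` with
`ψ(N; q, a) = Σ_{1 ≤ m ≤ N, m ≡ a (q)} Λ(m)` (values `qn + a ≤ 0` contribute `Λ(0) = 0`). [folklore] -/
theorem sum_vonMangoldt_linear_eq (hq : 0 < q) (x : ℕ) :
    ∑ n ∈ Icc 1 x, ArithmeticFunction.vonMangoldt (q * n + a).toNat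
      = ∑ m ∈ Icc 1 (q * x + a).toNat, ArithmeticFunction.vonMangoldt.residueClass (a : ZMod q.toNat) m
        - ∑ m ∈ Icc 1 a.toNat, ArithmeticFunction.vonMangoldt.residueClass (a : ZMod q.toNat) m := by
  induction x with
  | zero => simp
  | succ x ih =>
    rw [sum_Icc_succ_top (Nat.le_add_left 1 x), ih]
    have hmono : (q * x + a).toNat ≤ (q * (x + 1 : ℕ) + a).toNat := by
      apply Int.toNat_le_toNat; push_cast; nlinarith
    have hIcc : ∀ N : ℕ, Icc 1 N = Ioc 0 N := fun N => rfl
    rw [hIcc, hIcc, hIcc, ← sum_Ioc_consecutive _ (Nat.zero_le _) hmono]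
    push_cast
    rw [sum_Ioc_residueClass_step q a hq x]
    ring

/-- `Σ_{1 ≤ n ≤ x} Λ((qn + a)⁺) ∼ (q/φ(q))·x` for `q ≥ 1`, `gcd(q, a) = 1`: the prime number theorem for the
progression `a (mod q)` (tree: `vonMangoldt_residueClass_sum_isLittleO`, Wiener–Ikehara) transported through
the sampling identity. [folklore] -/
theorem sum_vonMangoldt_linear_isEquivalent (hq : 0 < q) (ha : IsUnit (a : ZMod q.toNat)) :
    (fun x : ℕ => ∑ n ∈ Icc 1 x, ArithmeticFunction.vonMangoldt (q * n + a).toNat)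
      ~[atTop] fun x : ℕ => ((q.toNat : ℝ) / Nat.totient q.toNat) * (x : ℝ) := by
  have hid := sum_vonMangoldt_linear_eq q a hq
  set Q : ℕ := q.toNat with hQ
  have hQq : (Q : ℤ) = q := Int.toNat_of_nonneg hq.le
  have hQpos : 0 < Q := by omega
  haveI : NeZero Q := ⟨hQpos.ne'⟩
  have hφ : (0 : ℝ) < Nat.totient Q := by exact_mod_cast Nat.totient_pos.mpr hQpos
  set T : ℕ → ℕ := fun x => (q * x + a).toNat with hT
  set ψ : ℕ → ℝ := fun N => ∑ m ∈ Icc 1 N, ArithmeticFunction.vonMangoldt.residueClass (a : ZMod Q) m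
    with hψ
  -- PNT in the progression, along `T x → ∞`
  have hTx : ∀ x : ℕ, x - a.natAbs ≤ T x := by
    intro x
    have h1 : (x : ℤ) - a.natAbs ≤ q * x + a := by
      have : (x : ℤ) ≤ q * x := by nlinarith
      have : -(a.natAbs : ℤ) ≤ a := by omega
      omega
    have h2 : ((x - a.natAbs : ℕ) : ℤ) ≤ (((q * x + a).toNat : ℕ) : ℤ) := by
      rcases le_or_gt a.natAbs x with h | h
      · rw [Nat.cast_sub h]
        exact h1.trans (Int.self_le_toNat _)
      · rw [Nat.sub_eq_zero_of_le h.le, Nat.cast_zero]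
        exact Int.natCast_nonneg _
    exact_mod_cast h2
  have hTtop : Tendsto T atTop atTop :=
    tendsto_atTop_mono hTx (tendsto_sub_atTop_nat a.natAbs)
  have h1 : (fun x : ℕ => ψ (T x) - (Nat.totient Q : ℝ)⁻¹ * (T x : ℝ)) =o[atTop]
      fun x : ℕ => ((T x : ℕ) : ℝ) :=
    (Literature.NumberTheory.LFunctions.vonMangoldt_residueClass_sum_isLittleO ha).comp_tendsto hTtop
  -- `T x = O(x)`
  have h2 : (fun x : ℕ => ((T x : ℕ) : ℝ)) =O[atTop] fun x : ℕ => (x : ℝ) := by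
    refine IsBigO.of_bound ((Q : ℝ) + a.toNat) ?_
    filter_upwards [eventually_ge_atTop 1] with x hx
    rw [Real.norm_eq_abs, Real.norm_eq_abs, abs_of_nonneg (Nat.cast_nonneg _),
      abs_of_nonneg (Nat.cast_nonneg _)]
    have hle : (T x : ℤ) ≤ Q * x + a.toNat := by
      have ha' : a ≤ a.toNat := Int.self_le_toNat a
      have h0 : (0 : ℤ) ≤ Q * x + a.toNat := by positivity
      rcases le_or_gt 0 (q * x + a) with h | h
      · simp only [hT]; rw [Int.toNat_of_nonneg h, ← hQq]; omega
      · simp only [hT]; rw [Int.toNat_eq_zero.mpr h.le]; exact_mod_cast h0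
    have hle' : (T x : ℝ) ≤ Q * x + a.toNat := by exact_mod_cast hle
    have hx1 : (1 : ℝ) ≤ x := by exact_mod_cast hx
    nlinarith [hle', hx1, (Nat.cast_nonneg a.toNat : (0 : ℝ) ≤ a.toNat)]
  -- the main terms differ by an eventually constant amount
  have h3 : (fun x : ℕ => (Nat.totient Q : ℝ)⁻¹ * (T x : ℝ) - (Q : ℝ) / Nat.totient Q * x) =o[atTop]
      fun x : ℕ => (x : ℝ) := by
    have hc : (fun x : ℕ => (Nat.totient Q : ℝ)⁻¹ * (a : ℝ)) =o[atTop] fun x : ℕ => (x : ℝ) := by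
      refine isLittleO_const_left.mpr (Or.inr ?_)
      exact tendsto_norm_atTop_atTop.comp tendsto_natCast_atTop_atTop
    refine hc.congr' ?_ EventuallyEq.rfl
    filter_upwards [eventually_ge_atTop a.natAbs] with x hx
    have hpos : 0 ≤ q * x + a := by
      have : (x : ℤ) ≤ q * x := by nlinarith
      omega
    have hTZ : ((T x : ℕ) : ℝ) = (q : ℝ) * x + a := by
      have : ((T x : ℕ) : ℤ) = q * x + a := Int.toNat_of_nonneg hpos
      exact_mod_cast this
    have hqQ : (q : ℝ) = (Q : ℝ) := by exact_mod_cast hQq.symm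
    rw [hTZ, hqQ]
    field_simp
    ring
  -- the constant `ψ(a⁺; q, a)`
  have h4 : (fun _ : ℕ => ψ a.toNat) =o[atTop] fun x : ℕ => (x : ℝ) := by
    refine isLittleO_const_left.mpr (Or.inr ?_)
    exact tendsto_norm_atTop_atTop.comp tendsto_natCast_atTop_atTop
  -- assemble
  have hsum := ((h1.trans_isBigO h2).add h3).sub h4
  have hkey : (fun x : ℕ => ∑ n ∈ Icc 1 x, ArithmeticFunction.vonMangoldt (q * n + a).toNat
      - (Q : ℝ) / Nat.totient Q * x) =o[atTop] fun x : ℕ => (x : ℝ) := by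
    refine hsum.congr' (Eventually.of_forall fun x => ?_) EventuallyEq.rfl
    simp only [hψ, hT]
    rw [hid x]
    ring
  have hQne : (Q : ℝ) / Nat.totient Q ≠ 0 := div_ne_zero (by exact_mod_cast hQpos.ne') hφ.ne'
  exact hkey.trans_isBigO (isBigO_self_const_mul hQne (fun x : ℕ => (x : ℝ)) atTop)

end Lambda

end DegreeOneLocal

/-! ### v8 (lead c2): the degree-one slice is a THEOREM -/

/-- STUB `stub_degreeOneSlice` (v8, lead c2; the only slice on which Bateman–Horn is KNOWN). For every
Bateman–Horn system consisting of ONE polynomial of degree `1` (`f = (qX + a)`, `q ≥ 1`, `gcd(q, a) = 1`) and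
EVERY `η ∈ (0,1)` the Möbius tail is `o(x)`: the prime number theorem for the progression `a (mod q)` in
`Λ`-form (`Σ_{n≤x} Λ(qn+a) ∼ (q/φ(q))·x`, tree `vonMangoldt_residueClass_sum_isLittleO`) against the Type-I
main term (`typeIMainTerm_proof`, constant `C(f) = q/φ(q)` by uniqueness of the ordered Euler-product limit),
subtracted (`Negative.tail_isLittleO_of_isEquivalent`). On this slice the composition below does not touch
`stub_naturalLogTail`. -/
theorem stub_degreeOneSlice : ∀ (f : Fin 1 → ℤ[X]),
    Literature.NumberTheory.Sieve.IsBatemanHornSystem f → (f 0).natDegree = 1 →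
      ∀ η : ℝ, 0 < η → η < 1 →
        (fun x : ℕ => ∑ n ∈ Finset.Icc 1 x,
          ∑ d ∈ Fintype.piFinset (fun i => (((f i).eval (n : ℤ)).toNat).divisors),
            if (x : ℝ) ^ (1 - η) < ∏ i, (d i : ℝ) then
              ∏ i, ((ArithmeticFunction.moebius (d i) : ℝ) * Real.log (d i)) else 0)
          =o[atTop] fun x : ℕ => (x : ℝ) := by
  -- LANDED p114749 (`Theorems/IsogenyRedeiPolyMobiusTailStubDegreeOneSlice.lean`, lead c2); local copy of
  -- the landed tactic proof over `DegreeOneLocal` until the farm has built the tree module.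
  intro f hf hdeg η hη0 hη1
  obtain ⟨C, -, hHas, hM⟩ := Summit.Parity.BatemanHorn.Theorems.typeIMainTerm_proof 1 f hf η hη0 hη1
  have hCC : C = ((f 0).leadingCoeff.toNat : ℝ) / Nat.totient (f 0).leadingCoeff.toNat :=
    tendsto_nhds_unique hHas (DegreeOneLocal.hasBatemanHornConst hf hdeg)
  subst hCC
  refine Summit.Parity.BatemanHorn.Theorems.PolyMobiusTail.Negative.tail_isLittleO_of_isEquivalent f ?_ hM
  -- the `Λ`-side: `Σ_{n≤x} Λ(f(n)) ∼ (q/φ(q))·x`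
  set q : ℤ := (f 0).leadingCoeff with hq
  set a : ℤ := (f 0).coeff 0 with ha
  have hqpos : 0 < q := hf.leadingCoeff_pos 0
  obtain ⟨hQpos, hQq⟩ := DegreeOneLocal.leadingCoeff_toNat hf
  -- `gcd(q, a) = 1`
  have hgcd : Int.gcd q a = 1 := by
    by_contra hne
    obtain ⟨p, hp, hpg⟩ := Nat.exists_prime_and_dvd hne
    have hpg' : (p : ℤ) ∣ (Int.gcd q a : ℤ) := Int.natCast_dvd_natCast.mpr hpg
    exact DegreeOneLocal.not_dvd_coeff_zero hf hdeg hp (hpg'.trans (Int.gcd_dvd_left q a))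
      (hpg'.trans (Int.gcd_dvd_right q a))
  have hunit : IsUnit (a : ZMod q.toNat) := by
    rw [ZMod.coe_int_isUnit_iff_isCoprime, hQq, Int.isCoprime_iff_gcd_eq_one]
    exact hgcd
  have hΛ := DegreeOneLocal.sum_vonMangoldt_linear_isEquivalent q a hqpos hunit
  refine hΛ.congr_left (Eventually.of_forall fun x => ?_)
  refine Finset.sum_congr rfl fun n _ => ?_
  rw [Fin.prod_univ_one, DegreeOneLocal.eval_eq hdeg]


/-! ## Glue -/

/-- Abstract form of the assembly of bridge 1: if `D n y` vanishes once `y ≥ M n`, expands for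
`n ≥ N` as `Σ_{s∈T} c_s · U_s(n,y)`, each `U_s(n,·)` is bounded, and each `Σ_{n≤x} U_s(n, g x) = o(x)`
with `g → ∞`, then `Σ_{n≤x} D(n, g x) = o(x)`. -/
theorem isLittleO_sum_of_expansion {σ : Type*} (T : Finset σ) (c : σ → ℝ) (D : ℕ → ℝ → ℝ)
    (U : σ → ℕ → ℝ → ℝ) (M : ℕ → ℝ) (g : ℕ → ℝ) (N : ℕ)
    (h0 : ∀ n y, M n ≤ y → D n y = 0)
    (h1 : ∀ n y, N ≤ n → D n y = ∑ s ∈ T, c s * U s n y)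
    (h2 : ∀ s ∈ T, ∀ n, ∃ B, ∀ y, |U s n y| ≤ B)
    (h3 : ∀ s ∈ T, (fun x : ℕ => ∑ n ∈ Finset.Icc 1 x, U s n (g x)) =o[atTop] fun x : ℕ => (x : ℝ))
    (hg : Tendsto g atTop atTop) :
    (fun x : ℕ => ∑ n ∈ Finset.Icc 1 x, D n (g x)) =o[atTop] fun x : ℕ => (x : ℝ) := by
  choose! B hB using h2
  -- the eventual identity
  have key : ∀ᶠ x : ℕ in atTop, (∑ s ∈ T, c s * ((∑ n ∈ Finset.Icc 1 x, U s n (g x))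
      - ∑ n ∈ (Finset.Icc 1 x).filter (fun n => n < N), U s n (g x)))
        = ∑ n ∈ Finset.Icc 1 x, D n (g x) := by
    filter_upwards [hg.eventually_ge_atTop (∑ n ∈ Finset.range N, |M n|)] with x hx
    rw [← Finset.sum_filter_add_sum_filter_not (Finset.Icc 1 x) (fun n => n < N) (fun n => D n (g x))]
    have hA : ∑ n ∈ (Finset.Icc 1 x).filter (fun n => n < N), D n (g x) = 0 := by
      refine Finset.sum_eq_zero fun n hn => h0 _ _ ?_
      have hn' : n < N := (Finset.mem_filter.1 hn).2
      calc M n ≤ |M n| := le_abs_self _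
        _ ≤ ∑ n ∈ Finset.range N, |M n| :=
            Finset.single_le_sum (f := fun n => |M n|) (fun _ _ => abs_nonneg _)
              (Finset.mem_range.2 hn')
        _ ≤ g x := hx
    have hB' : ∑ n ∈ (Finset.Icc 1 x).filter (fun n => ¬ n < N), D n (g x)
        = ∑ s ∈ T, c s * ∑ n ∈ (Finset.Icc 1 x).filter (fun n => ¬ n < N), U s n (g x) := by
      rw [Finset.sum_congr rfl (fun n hn => h1 n (g x) (not_lt.1 (Finset.mem_filter.1 hn).2)),
        Finset.sum_comm]
      simp only [Finset.mul_sum]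
    have hC : ∀ s, ∑ n ∈ (Finset.Icc 1 x).filter (fun n => ¬ n < N), U s n (g x)
        = ∑ n ∈ Finset.Icc 1 x, U s n (g x)
          - ∑ n ∈ (Finset.Icc 1 x).filter (fun n => n < N), U s n (g x) := by
      intro s
      have := Finset.sum_filter_add_sum_filter_not (Finset.Icc 1 x) (fun n => n < N)
        (fun n => U s n (g x))
      linarith
    rw [hA, zero_add, hB']
    exact Finset.sum_congr rfl fun s _ => by rw [hC]
  refine IsLittleO.congr' ?_ key EventuallyEq.rfl
  refine IsLittleO.sum fun s hs => IsLittleO.const_mul_left ((h3 s hs).sub ?_) _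
  -- the initial segment is bounded, hence `o(x)`
  have hbound : ∀ x : ℕ, |∑ n ∈ (Finset.Icc 1 x).filter (fun n => n < N), U s n (g x)|
      ≤ ∑ n ∈ Finset.range N, B s n := by
    intro x
    refine (Finset.abs_sum_le_sum_abs _ _).trans ?_
    refine (Finset.sum_le_sum fun n _ => hB s hs n (g x)).trans ?_
    refine Finset.sum_le_sum_of_subset_of_nonneg ?_ fun n _ _ => (abs_nonneg _).trans (hB s hs n (g 0))
    intro n hn
    exact Finset.mem_range.2 (Finset.mem_filter.1 hn).2
  have h1' : (fun x : ℕ => ∑ n ∈ (Finset.Icc 1 x).filter (fun n => n < N), U s n (g x))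
      =O[atTop] fun _ : ℕ => (1 : ℝ) := by
    refine IsBigO.of_bound (∑ n ∈ Finset.range N, B s n) (Eventually.of_forall fun x => ?_)
    rw [Real.norm_eq_abs, norm_one, mul_one]
    exact hbound x
  refine h1'.trans_isLittleO ?_
  refine isLittleO_const_left.2 (Or.inr ?_)
  exact tendsto_norm_atTop_atTop.comp tendsto_natCast_atTop_atTop

/-- For a divisor tuple `d` of the values, `∏ dᵢ ≤ ∏ fᵢ(n).toNat` (as reals). -/
theorem prod_cast_le_of_mem_piFinset {k : ℕ} (m : Fin k → ℕ) {d : Fin k → ℕ}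
    (hd : d ∈ Fintype.piFinset fun i => (m i).divisors) :
    ∏ i, (d i : ℝ) ≤ ∏ i, (m i : ℝ) :=
  Finset.prod_le_prod (fun _ _ => Nat.cast_nonneg _)
    fun i _ => Nat.cast_le.2 (Nat.divisor_le (Fintype.mem_piFinset.1 hd i))

/-- Bridge 1 of the card for `η ∈ (1/2, 1)`, from stubs 1–3: at the common cut-off `x^{1-η}`,
`Σ_{n≤x} ((-1)^k·routeTail − naturalTail) = o(x)`. -/
theorem routeTailToNaturalTail_of_stubs : ∀ (k : ℕ) (f : Fin k → ℤ[X]),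
    Literature.NumberTheory.Sieve.IsBatemanHornSystem f → ∀ η : ℝ, 1 / 2 < η → η < 1 →
      (fun x : ℕ => ∑ n ∈ Finset.Icc 1 x,
        ((-1 : ℝ) ^ k * (∑ d ∈ Fintype.piFinset (fun i => (((f i).eval (n : ℤ)).toNat).divisors),
            if (x : ℝ) ^ (1 - η) < ∏ i, (d i : ℝ) then
              ∏ i, ((ArithmeticFunction.moebius (d i) : ℝ) * Real.log (d i)) else 0)
          - (∑ d ∈ Fintype.piFinset (fun i => (((f i).eval (n : ℤ)).toNat).divisors),
            if (x : ℝ) ^ (1 - η) < ∏ i, (d i : ℝ) then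
              ∏ i, ((ArithmeticFunction.moebius (d i) : ℝ) *
                Real.log ((((f i).eval (n : ℤ)).toNat : ℝ) / (d i : ℝ))) else 0)))
        =o[atTop] fun x : ℕ => (x : ℝ) := by
  intro k f hf η hη hη1
  obtain ⟨N, hN⟩ := eventually_two_le k f hf
  refine isLittleO_sum_of_expansion
    ((Finset.univ : Finset (Fin k)).powerset.filter (fun S => S.Nonempty))
    (fun S => (-1 : ℝ) ^ (Finset.univ \ S).card)
    (fun n y => (-1 : ℝ) ^ k * (∑ d ∈ Fintype.piFinset (fun i => (((f i).eval (n : ℤ)).toNat).divisors),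
        if y < ∏ i, (d i : ℝ) then ∏ i, ((ArithmeticFunction.moebius (d i) : ℝ) * Real.log (d i)) else 0)
      - (∑ d ∈ Fintype.piFinset (fun i => (((f i).eval (n : ℤ)).toNat).divisors),
        if y < ∏ i, (d i : ℝ) then
          ∏ i, ((ArithmeticFunction.moebius (d i) : ℝ) *
            Real.log ((((f i).eval (n : ℤ)).toNat : ℝ) / (d i : ℝ))) else 0))
    (fun S n y => (∏ i ∈ S, Real.log ((((f i).eval (n : ℤ)).toNat : ℝ))) *
      ∑ d ∈ Fintype.piFinset (fun i => (((f i).eval (n : ℤ)).toNat).divisors),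
        if ∏ i, (d i : ℝ) ≤ y then
          (∏ i, (ArithmeticFunction.moebius (d i) : ℝ)) * ∏ i ∈ Finset.univ \ S, Real.log (d i)
        else 0)
    (fun n => ∏ i, ((((f i).eval (n : ℤ)).toNat : ℕ) : ℝ))
    (fun x : ℕ => (x : ℝ) ^ (1 - η)) N ?_ ?_ ?_ ?_ ?_
  · -- h0: beyond `∏ fᵢ(n)` both tails are empty
    intro n y hy
    have hR : (∑ d ∈ Fintype.piFinset (fun i => (((f i).eval (n : ℤ)).toNat).divisors),
        if y < ∏ i, (d i : ℝ) then ∏ i, ((ArithmeticFunction.moebius (d i) : ℝ) * Real.log (d i)) else 0)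
        = 0 :=
      Finset.sum_eq_zero fun d hd => if_neg (not_lt.2 ((prod_cast_le_of_mem_piFinset _ hd).trans hy))
    have hA : (∑ d ∈ Fintype.piFinset (fun i => (((f i).eval (n : ℤ)).toNat).divisors),
        if y < ∏ i, (d i : ℝ) then
          ∏ i, ((ArithmeticFunction.moebius (d i) : ℝ) *
            Real.log ((((f i).eval (n : ℤ)).toNat : ℝ) / (d i : ℝ))) else 0) = 0 :=
      Finset.sum_eq_zero fun d hd => if_neg (not_lt.2 ((prod_cast_le_of_mem_piFinset _ hd).trans hy))
    simp only [hR, hA, mul_zero, sub_zero]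
  · -- h1: the pointwise expansion (stub 1) for `n ≥ N` (no value equals `1` by stub 2)
    intro n y hn
    have h := pointwise_expansion k f y n (fun i => by have := hN n hn i; omega)
    simp only [h]
    exact Finset.sum_congr rfl fun S _ => mul_assoc _ _ _
  · -- h2: each `U_S(n, ·)` is bounded (by `|∏ log fᵢ(n)| · Σ_d |weight|`)
    intro S _ n
    refine ⟨|∏ i ∈ S, Real.log ((((f i).eval (n : ℤ)).toNat : ℝ))| *
      ∑ d ∈ Fintype.piFinset (fun i => (((f i).eval (n : ℤ)).toNat).divisors),
        |(∏ i, (ArithmeticFunction.moebius (d i) : ℝ)) * ∏ i ∈ Finset.univ \ S, Real.log (d i)|,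
      fun y => ?_⟩
    rw [abs_mul]
    refine mul_le_mul_of_nonneg_left ?_ (abs_nonneg _)
    refine (Finset.abs_sum_le_sum_abs _ _).trans (Finset.sum_le_sum fun d _ => ?_)
    split_ifs
    · exact le_rfl
    · rw [abs_zero]; exact abs_nonneg _
  · -- h3: stub 3
    intro S hS
    exact signedTypeI_isLittleO k f hf η hη hη1 S (Finset.mem_filter.1 hS).2
  · exact (tendsto_rpow_atTop (by linarith)).comp tendsto_natCast_atTop_atTop

/-- The general composition for `k ≥ 1` (`η = 3/4`): bridge 1 + strip + natural log tail, recombined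
pointwise in `n`. -/
theorem tail_of_stubs (k : ℕ) (hk : 0 < k) (f : Fin k → ℤ[X])
    (hf : Literature.NumberTheory.Sieve.IsBatemanHornSystem f) :
    ∃ η : ℝ, 0 < η ∧ η < 1 ∧
      (fun x : ℕ => ∑ n ∈ Finset.Icc 1 x,
        ∑ d ∈ Fintype.piFinset (fun i => (((f i).eval (n : ℤ)).toNat).divisors),
          if (x : ℝ) ^ (1 - η) < ∏ i, (d i : ℝ) then
            ∏ i, ((ArithmeticFunction.moebius (d i) : ℝ) * Real.log (d i)) else 0)
        =o[Filter.atTop] fun x : ℕ => (x : ℝ) := by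
  refine ⟨3 / 4, by norm_num, by norm_num, ?_⟩
  have e1 := routeTailToNaturalTail_of_stubs k f hf (3 / 4) (by norm_num) (by norm_num)
  have e2 := strip_bound k hk f hf (3 / 4) (by norm_num) (by norm_num)
  have e3 := stub_naturalLogTail k f hf
  have e := ((e1.add e2).add e3).const_mul_left ((-1 : ℝ) ^ k)
  refine e.congr' (Eventually.of_forall fun x => ?_) EventuallyEq.rfl
  have hk : ((-1 : ℝ) ^ k) * ((-1 : ℝ) ^ k) = 1 := by
    rw [← mul_pow]; norm_num
  beta_reduce
  rw [← Finset.sum_add_distrib, ← Finset.sum_add_distrib, Finset.mul_sum]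
  refine Finset.sum_congr rfl fun n _ => ?_
  generalize (∑ d ∈ Fintype.piFinset (fun i => (((f i).eval (n : ℤ)).toNat).divisors),
      if (x : ℝ) ^ (1 - 3 / 4 : ℝ) < ∏ i, (d i : ℝ) then
        ∏ i, ((ArithmeticFunction.moebius (d i) : ℝ) * Real.log (d i)) else 0) = R at *
  generalize (∑ d ∈ Fintype.piFinset (fun i => (((f i).eval (n : ℤ)).toNat).divisors),
      if (x : ℝ) ^ (1 - 3 / 4 : ℝ) < ∏ i, (d i : ℝ) then
        ∏ i, ((ArithmeticFunction.moebius (d i) : ℝ) *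
          Real.log ((((f i).eval (n : ℤ)).toNat : ℝ) / (d i : ℝ))) else 0) = A at *
  generalize (∑ d ∈ Fintype.piFinset (fun i => (((f i).eval (n : ℤ)).toNat).divisors),
      if (x : ℝ) / Real.log x ^ (2 * k + 2) < ∏ i, (d i : ℝ) then
        ∏ i, ((ArithmeticFunction.moebius (d i) : ℝ) *
          Real.log ((((f i).eval (n : ℤ)).toNat : ℝ) / (d i : ℝ))) else 0) = B at *
  linear_combination R * hk

/-- The crux BY NAME: `k = 0` is trivial (`Negative.polyMobiusTail_fin_zero`); the degree-one slice
(`k = 1`, `deg f₀ = 1`) is the THEOREM `stub_degreeOneSlice` (v8); every other system goes through the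
general composition `tail_of_stubs` (bridge 1 + strip + `stub_naturalLogTail`). -/
theorem PolyMobiusTail_of : Summit.Parity.BatemanHorn.Theses.PolynomialMobius.PolyMobiusTail := by
  intro k f hf
  rcases k with _ | k
  · exact Summit.Parity.BatemanHorn.Theorems.PolyMobiusTail.Negative.polyMobiusTail_fin_zero f
  rcases k with _ | k
  · by_cases hdeg : (f 0).natDegree = 1
    · exact ⟨3 / 4, by norm_num, by norm_num,
        stub_degreeOneSlice f hf hdeg (3 / 4) (by norm_num) (by norm_num)⟩
    · exact tail_of_stubs 1 one_pos f hf
  · exact tail_of_stubs (k + 2) (by omega) f hf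

/-- The same conclusion for the identical decl of route IsogenyRedei (the lead's route affinity). -/
theorem PolyMobiusTail_of_isogenyRedei : Summit.Parity.BatemanHorn.Theses.IsogenyRedei.PolyMobiusTail :=
  PolyMobiusTail_of

/-! ## Certificate (v8.1): the one open stub IS the crux

`stub_naturalLogTail` is not merely sufficient: it is UNCONDITIONALLY EQUIVALENT to the crux (tree, p112639,
via `typeIMainTerm_proof`), and the crux is `Λ`-Bateman–Horn for every system
(`Negative/Equivalence.polyMobiusTail_iff_lambdaBatemanHorn typeIMainTerm_proof`). So after v8 the line's residual
is Bateman–Horn in every OPEN case (every system off the degree-one slice), and nothing smaller. -/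

/-- The registered open stub, verbatim, is equivalent to the crux (re-export of the tree certificate
`…Theorems.PolyMobiusTail.NaturalForm.stub_naturalLogTail_iff_polyMobiusTail`, p112639). -/
theorem openStub_iff_crux :
    (∀ (k : ℕ) (f : Fin k → ℤ[X]), Literature.NumberTheory.Sieve.IsBatemanHornSystem f →
      (fun x : ℕ => ∑ n ∈ Finset.Icc 1 x,
        ∑ d ∈ Fintype.piFinset (fun i => (((f i).eval (n : ℤ)).toNat).divisors),
          if (x : ℝ) / Real.log x ^ (2 * k + 2) < ∏ i, (d i : ℝ) then
            ∏ i, ((ArithmeticFunction.moebius (d i) : ℝ) *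
              Real.log ((((f i).eval (n : ℤ)).toNat : ℝ) / (d i : ℝ))) else 0)
        =o[atTop] fun x : ℕ => (x : ℝ))
    ↔ Summit.Parity.BatemanHorn.Theses.IsogenyRedei.PolyMobiusTail :=
  Summit.Parity.BatemanHorn.Theorems.PolyMobiusTail.NaturalForm.stub_naturalLogTail_iff_polyMobiusTail

/-- Hence the crux is equivalent to `Λ`-form Bateman–Horn for every system, unconditionally
(`Negative/Equivalence.lean` + `typeIMainTerm_proof`). -/
theorem crux_iff_lambdaBatemanHorn :
    Summit.Parity.BatemanHorn.Theses.IsogenyRedei.PolyMobiusTail ↔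
      ∀ (k : ℕ) (f : Fin k → ℤ[X]), Literature.NumberTheory.Sieve.IsBatemanHornSystem f →
        ∃ C : ℝ, 0 < C ∧ Literature.NumberTheory.Sieve.HasBatemanHornConst f C ∧
          (fun x : ℕ => ∑ n ∈ Finset.Icc 1 x, ∏ i, ArithmeticFunction.vonMangoldt (((f i).eval (n : ℤ)).toNat))
            ~[atTop] (fun x : ℕ => C * (x : ℝ)) :=
  Summit.Parity.BatemanHorn.Theorems.PolyMobiusTail.Negative.polyMobiusTail_iff_lambdaBatemanHorn
    Summit.Parity.BatemanHorn.Theorems.typeIMainTerm_proof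

end Summit.Parity.BatemanHorn.Cruxes.PolyMobiusTail.NaturalForm
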